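import Summits.KontsevichZagierPeriods.KontsevichZagierPeriods.Theorems.MzvKernelInKZTwoPosetsDefs
import Literature.NumberTheory.Transcendental.MultipleZetaValuesDimBoundProofs
import Mathlib.LinearAlgebra.Dimension.OrzechProperty
import Mathlib.LinearAlgebra.LinearIndependent.Lemmas

/-!
# `MzvKernelInKZ` (stmt-KontsevichZagierPeriods-3914), line two-posets-interior-landen:
# Hoffman independence from Zagier's conjecture and Brown's theorem

Stub `stub_hoffmanIndependentOfZagier` of the lead's skeleton: the transcendence bridge
`ZagierConjecture → hoffmanSpan_eq_mzvSpace → HoffmanIndependent`.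

`HoffmanIndependent` (vocabulary of the line, `MzvKernelInKZTwoPosetsDefs`) is the `ℚ`-linear
independence, inside `ℝ`, of ALL real Hoffman values `ζ(s)`, `s ∈ {2,3}^×` (all weights at once,
the empty index giving `ζ(∅) = 1`). It is open, but it follows by linear algebra from the two
named transcendence inputs of the tree:

* Zagier's conjecture `ZagierConjecture = ZagierDimensionConjecture ∧ MZVWeightGradingConjecture`
  (Zagier, ECM 1992, §9; Goncharov, ECM 2000, Conjecture 1.1): `dim_ℚ 𝒵_n = d_n` for every weight
  `n`, and the weight spaces `𝒵_n = mzvSpace n ⊆ ℝ` form a direct sum (`iSupIndep mzvSpace`);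
* Brown's theorem `hoffmanSpan_eq_mzvSpace` (Brown, *Mixed Tate motives over ℤ*, Ann. of Math. 175
  (2012), Theorem 1.1): the Hoffman values of weight `n` span `𝒵_n`.

Proof. Fix a weight `n`. The Hoffman indices of weight `n` form a finite type of cardinality
`d_n = zagierDim n` (`finite_hoffman`, `zagierDim_eq_card_hoffman_holds`); their values span
`hoffmanSpan n = mzvSpace n` (Brown), a space of `finrank` `d_n` (Zagier); `d_n` vectors spanning a
space of dimension `d_n` are linearly independent (`linearIndependent_iff_card_eq_finrank_span`).
Across weights, the spans of the weight-wise families sit inside the `mzvSpace n`, which are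
independent subspaces (grading conjecture), so the `Σ`-family over all weights is independent
(`linearIndependent_iUnion_finite`); finally `{s // IsHoffman s}` embeds into
`Σ n, {s // IsHoffman s ∧ weight s = n}` by `s ↦ ⟨weight s, s⟩`, compatibly with the values.

No new definitions; imports: the line's vocabulary `MzvKernelInKZTwoPosetsDefs` (for
`HoffmanIndependent`), `MultipleZetaValuesDimBoundProofs`
(`finite_hoffman`, `zagierDim_eq_card_hoffman_holds`), and Mathlib linear algebra
(`OrzechProperty`: `linearIndependent_iff_card_eq_finrank_span`; `LinearIndependent.Lemmas`:
`linearIndependent_iUnion_finite`).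
-/

noncomputable section

namespace Summit.KontsevichZagierPeriods.MzvKernelInKZ.TwoPosets

open Set MeasureTheory
open Literature.NumberTheory.Transcendental
open Summit.KontsevichZagierPeriods.MzvKernelInKZ.Negative

/-! ## One weight at a time -/

/-- The Hoffman span of weight `n` is the span of the range of the family `s ↦ ζ(s)` indexed by
the Hoffman indices of weight `n` (the same set of generators, written as a range; cf.
`hoffmanSpan_eq_span_range` in `MultipleZetaValuesHoffmanProofs`). -/
theorem span_range_multipleZeta_hoffman (n : ℕ) :
    Submodule.span ℚ (Set.range
      fun s : {s : List ℕ // MZV.IsHoffman s ∧ MZV.weight s = n} => multipleZeta s.1) =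
      hoffmanSpan n := by
  unfold hoffmanSpan
  congr 1
  ext x
  simp only [Set.mem_setOf_eq, Set.mem_range, Subtype.exists, exists_prop]
  constructor
  · rintro ⟨s, ⟨hs, hw⟩, rfl⟩
    exact ⟨s, hs, hw, rfl⟩
  · rintro ⟨s, hs, hw, rfl⟩
    exact ⟨s, ⟨hs, hw⟩, rfl⟩

/-- **Per weight.** Under Zagier's dimension conjecture (`dim_ℚ 𝒵_n = d_n`) and Brown's theorem
(the Hoffman values of weight `n` span `𝒵_n`), the `d_n` real Hoffman values of weight `n` are
`ℚ`-linearly independent: a finite family of `d_n` vectors spanning a space of dimension `d_n` is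
linearly independent. (The count `#{s ∈ {2,3}^× : |s| = n} = d_n` is
`zagierDim_eq_card_hoffman_holds`.) -/
theorem linearIndependent_multipleZeta_hoffman_weight (hZ : ZagierDimensionConjecture)
    (hB : hoffmanSpan_eq_mzvSpace) (n : ℕ) :
    LinearIndependent ℚ
      fun s : {s : List ℕ // MZV.IsHoffman s ∧ MZV.weight s = n} => multipleZeta s.1 := by
  haveI := finite_hoffman n
  letI := Fintype.ofFinite {s : List ℕ // MZV.IsHoffman s ∧ MZV.weight s = n}
  rw [linearIndependent_iff_card_eq_finrank_span]
  unfold Set.finrank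
  rw [span_range_multipleZeta_hoffman, hB n, hZ n, zagierDim_eq_card_hoffman_holds n,
    Nat.card_eq_fintype_card]

/-! ## Across weights -/

/-- **Across weights.** Under the weight-grading conjecture (`iSupIndep mzvSpace`: the weight
spaces `𝒵_n ⊆ ℝ` form a direct sum), the spans of the weight-wise Hoffman families — each
contained in its `𝒵_n` (a Hoffman index is admissible) — form an independent family of
`ℚ`-subspaces of `ℝ`. -/
theorem iSupIndep_span_multipleZeta_hoffman (hG : MZVWeightGradingConjecture) :
    iSupIndep fun n => Submodule.span ℚ (Set.range
      fun s : {s : List ℕ // MZV.IsHoffman s ∧ MZV.weight s = n} => multipleZeta s.1) :=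
  hG.mono fun n => (span_range_multipleZeta_hoffman n).le.trans (hoffmanSpan_le_mzvSpace n)

/-- **All weights, `Σ`-indexed.** Under Zagier's conjecture (dimension ∧ grading) and Brown's
theorem, the family of real Hoffman values indexed by `Σ n, {Hoffman indices of weight n}` is
`ℚ`-linearly independent: weight-wise independent families whose spans are independent
subspaces (`linearIndependent_iUnion_finite`). -/
theorem linearIndependent_multipleZeta_hoffman_sigma (hZ : ZagierConjecture)
    (hB : hoffmanSpan_eq_mzvSpace) :
    LinearIndependent ℚ
      fun ji : Σ n, {s : List ℕ // MZV.IsHoffman s ∧ MZV.weight s = n} =>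
        multipleZeta ji.2.1 :=
  linearIndependent_iUnion_finite
    (f := fun n (s : {s : List ℕ // MZV.IsHoffman s ∧ MZV.weight s = n}) => multipleZeta s.1)
    (linearIndependent_multipleZeta_hoffman_weight hZ.1 hB)
    fun _ _ _ hit => (iSupIndep_span_multipleZeta_hoffman hZ.2).disjoint_biSup hit

/-! ## The stub -/

/-- **Zagier's conjecture and Brown's theorem give Hoffman independence.** If
`dim_ℚ 𝒵_n = d_n` for all `n` and the weight spaces `𝒵_n ⊆ ℝ` form a direct sum (Zagier's
conjecture, ECM 1992 §9; Goncharov's Conjecture 1.1), and the Hoffman values of each weight span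
that weight space (Brown 2012, Theorem 1.1), then all real Hoffman values `ζ(s)`, `s ∈ {2,3}^×`,
are `ℚ`-linearly independent. Linear algebra: per weight, `d_n` spanning vectors of a
`d_n`-dimensional space are independent; across weights, independent subspaces; transport along
`s ↦ ⟨|s|, s⟩ : {2,3}^× ↪ Σ n, {s ∈ {2,3}^× : |s| = n}`. -/
theorem stub_hoffmanIndependentOfZagier :
    ZagierConjecture → hoffmanSpan_eq_mzvSpace → HoffmanIndependent := by
  intro hZ hB
  -- the weight-graded reindexing of the Hoffman indices
  let e : {s : List ℕ // MZV.IsHoffman s} →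
      Σ n, {s : List ℕ // MZV.IsHoffman s ∧ MZV.weight s = n} :=
    fun s => ⟨MZV.weight s.1, ⟨s.1, s.2, rfl⟩⟩
  have he : Function.Injective e :=
    Function.Injective.of_comp
      (f := fun ji : Σ n, {s : List ℕ // MZV.IsHoffman s ∧ MZV.weight s = n} => ji.2.1)
      Subtype.val_injective
  exact (linearIndependent_multipleZeta_hoffman_sigma hZ hB).comp e he

end Summit.KontsevichZagierPeriods.MzvKernelInKZ.TwoPosets
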